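/-
Copyright (c) 2026 the pub-hodgecm-mathlib formalisation cell (harness21).  Prover seat hodgecm-mathlib-LH4-p03 (g11): STAGE 1a of the (D-RAM) «FOUR-FRAME» road
(req618; heir LEAD F0P3a-plan (g18) DIRECTIVE `STAGE1a-DIRECTIVE-DRAM-FourFrame.v1` b9ecbbedecc9c5ae, D2 §1 item 2 «general-(q,d,t) pen theorems», D7 «LH4-p03»); 2026-09-03.
-/
import Literature.NumberTheory.LocalFields.WildQuadraticEisensteinFrame   -- ★ `exists_fixed_coords_of_map_ne` (coordinates `a + b·ϖ`), `v_fixed_add_fixed_mul_eq_max` (valuation splitting)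
import HarnessLib

/-!
# The RAMIFIED QUADRATIC DATUM `(σ, ϖ, d, t)` of a discretely valued field: `d ≤ t + 1`, the parity dichotomy `d` odd `⟺ d = t + 1`, the valuation parity of
# SKEW elements (`log v(s) ≡ d (mod 2)`), and the TRACE IMAGES `Tr 𝔭_E^j = 𝔭_F^{⌊(j+d)∕2⌋}` (Serre, *Local Fields* III §3 Prop. 7, III §6 Prop. 13 and Remark)

Topic `NumberTheory/LocalFields`; namespace `Literature.NumberTheory.LocalFields.WildQuadraticDatum` (the object: the one-field datum below).  THEOREMS ONLY (no definition,
no instance, no notation, no named fact, no `sorry`); abstract one-field currency `[Field K] [Valued K ℤᵐ⁰]` of ★ `WildQuadraticEisensteinFrame` and of the ★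
`UnitaryLatticeTree*` kit; NO completeness, NO finiteness of the residue field, NO `|2| = 1`, NO `σϖ = −ϖ`.  Cell `pub/hodgecm-mathlib` (D-0151), crux H413 =
`stmt-HodgeConjecture-24833`, STAGE 1a of the in-house road under organ (D-RAM) `stub_DyRamCore`; count-neutral (pays no organ): these are the datum-level identities every
unit of the road consumes — (ii-0) «no integral trace-one element once `d ≥ 2`» (the closed route of ★ `…SelfDualTransitiveOfTrace`), (iii)∕(G4) «`c = q` for every `d`»
(`Tr 𝔭_E^j = 𝔭_F^{⌊(j+d)∕2⌋}`, skew valuations `≡ d`), (U) «`d ≤ 2e_F + 1`».  HONEST LABEL: HC_CM is proved only modulo the 7 printed citations (2 remaining named inputs: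
hLiu418 = stmt-HodgeConjecture-24832, h413 = stmt-HodgeConjecture-24833) until rung 0 closes.

THE DATUM (= the conjuncts of the four-frame sheet's `IsRamifiedQuadraticDatum σ ϖ d t`, SIGSHEET v2 c03c627160493264 token D, taken here ONE BY ONE as hypotheses so that
no definition is needed): `σ : K →+* K` an involution (`hσ : σ (σ x) = x`), `ϖ ∈ K` with `v ϖ = exp(−1)` (`hϖ`; `E := K` is normalised, so `F := K^σ` has value group
`exp(2ℤ)`: `hfix : σ x = x → x ≠ 0 → ∃ n, v x = exp(2n)`), the DIFFERENT EXPONENT `d : ℕ` through `hd : v(ϖ − σϖ) = (v ϖ)^d`, and `t : ℕ` through `ht : v 2 = (v ϖ)^t`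
(`t = v_E(2) = 2·e_F`).  Writing every `x ∈ K` as `a + b·ϖ` with `σ`-fixed `a, b` (★ `exists_fixed_coords_of_map_ne`; `v x = max (v a) (v b·exp(−1))` by ★
`v_fixed_add_fixed_mul_eq_max`, i.e. `𝒪_E = 𝒪_F ⊕ 𝒪_F·ϖ`), the trace is `Tr(a + bϖ) = 2a + b·Tr ϖ`, `Tr ϖ = ϖ + σϖ`, and `ϖ − σϖ = 2ϖ − Tr ϖ` with `v(2ϖ) = exp(−(t+1))`
of ODD exponent and `v(Tr ϖ) ∈ exp(2ℤ) ∪ {0}`: the two never cancel.  Hence (Serre III §6 Prop. 13 and the Remark after it, at `e = 2`):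

* §1 `exists_v_eq_exp_of_map_eq_neg` — SKEW PARITY: `σs = −s`, `s ≠ 0 ⇒ v s = exp(2n − d)` (`s∕(ϖ − σϖ)` is `σ`-fixed).
* §2 `two_ne_zero`, `even_t` — `2 ≠ 0` in `K` (so `char K ≠ 2` is a CONSEQUENCE of the datum) and `t` is even.
* §3 `v_sub_map_eq_max` (`v(ϖ − σϖ) = max (v(2ϖ)) (v(Tr ϖ))`), `v_trace_varpi_le` (`v(Tr ϖ) ≤ (vϖ)^d`), `v_two_mul_varpi_le`, **`d_le_succ_t : d ≤ t + 1`** (= `d ≤ 2e_F + 1`),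
  the DICHOTOMY `v_trace_varpi_eq_or : v(Tr ϖ) = (vϖ)^d ∨ d = t + 1`, **`odd_iff_eq_succ : Odd d ↔ d = t + 1`** («R-P»), `v_trace_varpi_eq_of_even` («R-U»: `v(Tr ϖ) = (vϖ)^d`),
  `v_trace_varpi_le_succ_of_odd` (`v(Tr ϖ) ≤ (vϖ)^{d+1}`).
* §4 TRACE IMAGES `Tr 𝔭_E^j = 𝔭_F^{⌊(j+d)∕2⌋}` (Serre III §3 Prop. 7: `Tr 𝔟 ⊆ 𝔞 ⟺ 𝔟 ⊆ 𝔞𝒟⁻¹`), division-free: **`v_add_map_le_exp`** (`v x ≤ exp(−j)`, `2m ≤ j + d ⇒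
  v(x + σx) ≤ exp(−2m)`) and **`exists_v_le_add_map_eq`** (`σy = y`, `v y ≤ exp(−2m)`, `j + d ≤ 2m + 1 ⇒ ∃ x, v x ≤ exp(−j) ∧ x + σx = y`, with the explicit preimage
  `y∕2` when `d = t + 1` and `(y∕Tr ϖ)·ϖ` when `v(Tr ϖ) = (vϖ)^d`).
* §5 corollaries at `j = 0`: `Tr 𝒪_E ⊆ 𝔭_F^{⌊d∕2⌋}` (`v_add_map_le_exp_of_v_le_one`), **`v_add_map_lt_one_of_two_le`** and **`add_map_ne_one_of_two_le`** (NO integral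
  element of trace `1` — indeed of unit trace — once `d ≥ 2`: the hypothesis `htrace` of ★ `UnitaryLatticeTreeSelfDualTransitiveOfTrace` is unavailable at every wild
  place), `exists_integral_add_map_eq` (every `σ`-fixed `y` with `v y ≤ exp(−2m)`, `d ≤ 2m + 1`, is the trace of an integral element) and the tame sanity check
  `exists_integral_add_map_eq_one_of_d_eq_one` (`d = 1 ⇒` an integral element of trace `1` exists).

Not here: the residue field (`q`), the index statements `[X₂ : X₀]·[Sk ∩ 𝔭⁻¹ : Sk ∩ 𝒪] = q` of the (G4) horoball reading (they need `[Fintype 𝓀[K]]` and live with the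
census files), norms (★ `WildQuadraticNorm*`), and the two-field dress (★ `WildQuadraticEisensteinFrame` §4).  ★ neighbours in the CM-place currency `L_w ∕ L⁺_v`:
★ `RamifiedPlaceDifferentIdeal.trace_mem_iff_valued_add_le_one`, ★ `RamifiedPlaceTraceDual.exists_different_traceDual_of_ramified`, ★ `RamifiedPlaceOrderDiscriminant`.

## References
* [Serre1979] J.-P. Serre, *Local Fields*, GTM 67 (1979): Ch. I §6 Prop. 18 (`𝒪_E = 𝒪_F[ϖ]` for a totally ramified extension), Ch. III §3 Prop. 7 (p. 51: `Tr 𝔟 ⊆ 𝔞 ⟺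
  𝔟 ⊆ 𝔞·𝒟⁻¹`), Ch. III §6 Prop. 13 and Remark (p. 58: `𝒟 = (f′(π))`, `w(f′(π)) ≤ e − 1 + w(e)`, the terms of `f′(π)` have distinct valuations mod `e`).
-/

set_option autoImplicit false

open WithZero

namespace Literature.NumberTheory.LocalFields.WildQuadraticDatum

variable {K : Type*} [Field K] [Valued K ℤᵐ⁰] {σ : K →+* K} {ϖ : K} {d t : ℕ}

/-! ## §0 Bookkeeping: powers of `v ϖ`, non-vanishing of `ϖ − σϖ`, the parity token in the `log` form of ★ `WildQuadraticEisensteinFrame` -/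

/-- `(v ϖ)^n = exp(−n)` for the normalised `ϖ` (`v ϖ = exp(−1)`). [cite: Serre1979, Ch. I §6 Prop. 18] -/
theorem v_varpi_pow (hϖ : Valued.v ϖ = exp (-1 : ℤ)) (n : ℕ) : Valued.v ϖ ^ n = exp (-(n : ℤ)) := by
  rw [hϖ, ← exp_nsmul]
  congr 1
  simp

/-- `ϖ − σϖ ≠ 0` (its valuation is `(v ϖ)^d ≠ 0`): `σ` moves `ϖ`. [cite: Serre1979, Ch. III §6 Prop. 13] -/
theorem sub_map_ne_zero (hϖ : Valued.v ϖ = exp (-1 : ℤ)) (hd : Valued.v (ϖ - σ ϖ) = Valued.v ϖ ^ d) : ϖ - σ ϖ ≠ 0 := by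
  intro h
  rw [h, map_zero, v_varpi_pow hϖ] at hd
  exact exp_ne_zero hd.symm

/-- `σϖ ≠ ϖ`. [cite: Serre1979, Ch. III §6 Prop. 13] -/
theorem map_varpi_ne (hϖ : Valued.v ϖ = exp (-1 : ℤ)) (hd : Valued.v (ϖ - σ ϖ) = Valued.v ϖ ^ d) : σ ϖ ≠ ϖ :=
  fun h => sub_map_ne_zero hϖ hd (by rw [h, sub_self])

omit [Valued K ℤᵐ⁰] in
/-- `σ(ϖ − σϖ) = −(ϖ − σϖ)`: the different generator is SKEW. [cite: Serre1979, Ch. III §6 Prop. 13] -/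
theorem map_sub_map_eq_neg (hσ : ∀ x, σ (σ x) = x) : σ (ϖ - σ ϖ) = -(ϖ - σ ϖ) := by
  rw [map_sub, hσ, neg_sub]

omit [Valued K ℤᵐ⁰] in
/-- `σ(x + σx) = x + σx`: traces are `σ`-fixed. [cite: Serre1979, Ch. III §3 Prop. 7] -/
theorem map_add_map_eq_self (hσ : ∀ x, σ (σ x) = x) (x : K) : σ (x + σ x) = x + σ x := by
  rw [map_add, hσ, add_comm]

/-- The sheet's parity token `σx = x, x ≠ 0 ⇒ v x = exp(2n)` in the `Even (log v)` form consumed by ★ `WildQuadraticEisensteinFrame`. [cite: Serre1979, Ch. I §6 Prop. 18] -/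
theorem even_log_v_of_fixed (hfix : ∀ x : K, σ x = x → x ≠ 0 → ∃ n : ℤ, Valued.v x = exp (2 * n))
    (c : K) (hc : σ c = c) (hc0 : c ≠ 0) : Even (log (Valued.v c)) := by
  obtain ⟨n, hn⟩ := hfix c hc hc0
  exact ⟨n, by rw [hn, log_exp, two_mul]⟩

omit [Valued K ℤᵐ⁰] in
/-- The trace in coordinates: `Tr(a + bϖ) = 2a + b·Tr ϖ` for `σ`-fixed `a, b`. [cite: Serre1979, Ch. III §6 Prop. 13] -/
theorem add_map_of_coords {a b : K} (ha : σ a = a) (hb : σ b = b) :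
    (a + b * ϖ) + σ (a + b * ϖ) = 2 * a + b * (ϖ + σ ϖ) := by
  rw [map_add, map_mul, ha, hb]
  ring

/-! ## §1 Skew parity: `log v(s) ≡ d (mod 2)` for every skew `s ≠ 0` -/

/-- **SKEW PARITY.**  In the ramified quadratic datum (`σ` involution, `v ϖ = exp(−1)`, `σ`-fixed elements have even `log v`, `v(ϖ − σϖ) = (vϖ)^d`), every SKEW
element `s` (`σs = −s`, `s ≠ 0`) has `v s = exp(2n − d)` for some `n ∈ ℤ`: `s∕(ϖ − σϖ)` is `σ`-fixed.  (`d` odd: skew uniformisers exist — the «R-P»∕tame frame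
`σϖ′ = −ϖ′`; `d` even: every skew element has even valuation — «R-U».) [cite: Serre1979, Ch. III §6 Prop. 13] -/
theorem exists_v_eq_exp_of_map_eq_neg (hσ : ∀ x, σ (σ x) = x)
    (hfix : ∀ x : K, σ x = x → x ≠ 0 → ∃ n : ℤ, Valued.v x = exp (2 * n))
    (hϖ : Valued.v ϖ = exp (-1 : ℤ)) (hd : Valued.v (ϖ - σ ϖ) = Valued.v ϖ ^ d)
    {s : K} (hs : σ s = -s) (hs0 : s ≠ 0) : ∃ n : ℤ, Valued.v s = exp (2 * n - d) := by
  have hδ0 := sub_map_ne_zero hϖ hd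
  obtain ⟨n, hn⟩ := hfix (s / (ϖ - σ ϖ))
    (by rw [map_div₀, hs, map_sub_map_eq_neg hσ, neg_div_neg_eq]) (div_ne_zero hs0 hδ0)
  refine ⟨n, ?_⟩
  rw [← div_mul_cancel₀ s hδ0, map_mul, hn, hd, v_varpi_pow hϖ, ← exp_add, sub_eq_add_neg]

/-! ## §2 The constants: `2 ≠ 0` and `t` is even -/

/-- `2 ≠ 0` in `K` (its valuation is `(vϖ)^t ≠ 0`): residue characteristic `2` is allowed, characteristic `2` is excluded BY the datum. [cite: Serre1979, Ch. III §6 Prop. 13] -/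
theorem two_ne_zero (hϖ : Valued.v ϖ = exp (-1 : ℤ)) (ht : Valued.v (2 : K) = Valued.v ϖ ^ t) : (2 : K) ≠ 0 := by
  intro h
  rw [h, map_zero, v_varpi_pow hϖ] at ht
  exact exp_ne_zero ht.symm

/-- `t = v_E(2)` is EVEN (`2` is `σ`-fixed; `t = 2·e_F`). [cite: Serre1979, Ch. III §6 Prop. 13] -/
theorem even_t (hfix : ∀ x : K, σ x = x → x ≠ 0 → ∃ n : ℤ, Valued.v x = exp (2 * n))
    (hϖ : Valued.v ϖ = exp (-1 : ℤ)) (ht : Valued.v (2 : K) = Valued.v ϖ ^ t) : Even t := by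
  obtain ⟨n, hn⟩ := hfix 2 (map_ofNat σ 2) (two_ne_zero hϖ ht)
  rw [ht, v_varpi_pow hϖ, exp_inj] at hn
  exact Nat.even_iff.2 (by omega)

/-- `v(2ϖ) = exp(−(t + 1))` — ODD exponent. [cite: Serre1979, Ch. III §6 Prop. 13] -/
theorem v_two_mul_varpi (hϖ : Valued.v ϖ = exp (-1 : ℤ)) (ht : Valued.v (2 : K) = Valued.v ϖ ^ t) :
    Valued.v (2 * ϖ) = exp (-((t : ℤ) + 1)) := by
  rw [map_mul, ht, v_varpi_pow hϖ, hϖ, ← exp_add, neg_add]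

/-! ## §3 `ϖ − σϖ = 2ϖ − Tr ϖ`: the different exponent `d` versus `t`, and the parity dichotomy -/

/-- **`v(ϖ − σϖ) = max (v(2ϖ)) (v(ϖ + σϖ))`**: `ϖ − σϖ = 2ϖ − (ϖ + σϖ)`, where `v(2ϖ)` has odd exponent `−(t+1)` and the `σ`-fixed `ϖ + σϖ` has even exponent (or
vanishes) — no cancellation (Serre's Remark: the terms of `f′(π) = 2π − Tr π` have distinct valuations mod `e = 2`). [cite: Serre1979, Ch. III §6 Prop. 13] -/
theorem v_sub_map_eq_max (hσ : ∀ x, σ (σ x) = x)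
    (hfix : ∀ x : K, σ x = x → x ≠ 0 → ∃ n : ℤ, Valued.v x = exp (2 * n))
    (hϖ : Valued.v ϖ = exp (-1 : ℤ)) (ht : Valued.v (2 : K) = Valued.v ϖ ^ t) :
    Valued.v (ϖ - σ ϖ) = max (Valued.v (2 * ϖ)) (Valued.v (ϖ + σ ϖ)) := by
  have hrw : ϖ - σ ϖ = 2 * ϖ + -(ϖ + σ ϖ) := by ring
  rcases eq_or_ne (ϖ + σ ϖ) 0 with h0 | h0
  · rw [hrw, h0, neg_zero, add_zero, map_zero, max_eq_left zero_le]
  · have hne : Valued.v (2 * ϖ) ≠ Valued.v (-(ϖ + σ ϖ)) := by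
      rw [Valuation.map_neg]
      obtain ⟨p, hp⟩ := hfix _ (map_add_map_eq_self hσ ϖ) h0
      obtain ⟨e, he⟩ := even_t hfix hϖ ht
      rw [v_two_mul_varpi hϖ ht, hp]
      intro h
      rw [exp_inj] at h
      omega
    rw [hrw, Valuation.map_add_of_distinct_val _ hne, Valuation.map_neg]

/-- `v(Tr ϖ) ≤ (vϖ)^d` (`Tr ϖ = ϖ + σϖ`). [cite: Serre1979, Ch. III §6 Prop. 13] -/
theorem v_trace_varpi_le (hσ : ∀ x, σ (σ x) = x)
    (hfix : ∀ x : K, σ x = x → x ≠ 0 → ∃ n : ℤ, Valued.v x = exp (2 * n))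
    (hϖ : Valued.v ϖ = exp (-1 : ℤ)) (hd : Valued.v (ϖ - σ ϖ) = Valued.v ϖ ^ d) (ht : Valued.v (2 : K) = Valued.v ϖ ^ t) :
    Valued.v (ϖ + σ ϖ) ≤ Valued.v ϖ ^ d := by
  rw [← hd, v_sub_map_eq_max hσ hfix hϖ ht]
  exact le_max_right _ _

/-- `v(2ϖ) ≤ (vϖ)^d`. [cite: Serre1979, Ch. III §6 Prop. 13] -/
theorem v_two_mul_varpi_le (hσ : ∀ x, σ (σ x) = x)
    (hfix : ∀ x : K, σ x = x → x ≠ 0 → ∃ n : ℤ, Valued.v x = exp (2 * n))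
    (hϖ : Valued.v ϖ = exp (-1 : ℤ)) (hd : Valued.v (ϖ - σ ϖ) = Valued.v ϖ ^ d) (ht : Valued.v (2 : K) = Valued.v ϖ ^ t) :
    Valued.v (2 * ϖ) ≤ Valued.v ϖ ^ d := by
  rw [← hd, v_sub_map_eq_max hσ hfix hϖ ht]
  exact le_max_left _ _

/-- **`d ≤ t + 1`** — the different exponent of a ramified quadratic datum is at most `v_E(2) + 1 = 2e_F + 1` (Serre: `w(f′(π)) ≤ e − 1 + w(e)` at `e = 2`); the structural
half of the uniformity row (U) of the four-frame road. [cite: Serre1979, Ch. III §6 Prop. 13] -/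
theorem d_le_succ_t (hσ : ∀ x, σ (σ x) = x)
    (hfix : ∀ x : K, σ x = x → x ≠ 0 → ∃ n : ℤ, Valued.v x = exp (2 * n))
    (hϖ : Valued.v ϖ = exp (-1 : ℤ)) (hd : Valued.v (ϖ - σ ϖ) = Valued.v ϖ ^ d) (ht : Valued.v (2 : K) = Valued.v ϖ ^ t) :
    d ≤ t + 1 := by
  have h := v_two_mul_varpi_le hσ hfix hϖ hd ht
  rw [v_two_mul_varpi hϖ ht, v_varpi_pow hϖ, exp_le_exp] at h
  omega

/-- **THE DICHOTOMY**: either `v(Tr ϖ) = (vϖ)^d` (then `d` is even, «R-U») or `d = t + 1` (then `d` is odd, «R-P» ∕ tame `t = 0, d = 1`). [cite: Serre1979, Ch. III §6 Prop. 13] -/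
theorem v_trace_varpi_eq_or (hσ : ∀ x, σ (σ x) = x)
    (hfix : ∀ x : K, σ x = x → x ≠ 0 → ∃ n : ℤ, Valued.v x = exp (2 * n))
    (hϖ : Valued.v ϖ = exp (-1 : ℤ)) (hd : Valued.v (ϖ - σ ϖ) = Valued.v ϖ ^ d) (ht : Valued.v (2 : K) = Valued.v ϖ ^ t) :
    Valued.v (ϖ + σ ϖ) = Valued.v ϖ ^ d ∨ d = t + 1 := by
  have h := v_sub_map_eq_max hσ hfix hϖ ht
  rw [hd] at h
  rcases le_total (Valued.v (2 * ϖ)) (Valued.v (ϖ + σ ϖ)) with hle | hle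
  · left
    rw [h, max_eq_right hle]
  · right
    rw [max_eq_left hle, v_two_mul_varpi hϖ ht, v_varpi_pow hϖ, exp_inj] at h
    omega

/-- `d` odd `⇒ d = t + 1` (a `σ`-fixed `Tr ϖ` cannot have valuation `(vϖ)^d` of odd exponent). [cite: Serre1979, Ch. III §6 Prop. 13] -/
theorem eq_succ_of_odd (hσ : ∀ x, σ (σ x) = x)
    (hfix : ∀ x : K, σ x = x → x ≠ 0 → ∃ n : ℤ, Valued.v x = exp (2 * n))
    (hϖ : Valued.v ϖ = exp (-1 : ℤ)) (hd : Valued.v (ϖ - σ ϖ) = Valued.v ϖ ^ d) (ht : Valued.v (2 : K) = Valued.v ϖ ^ t)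
    (hodd : Odd d) : d = t + 1 := by
  rcases v_trace_varpi_eq_or hσ hfix hϖ hd ht with h | h
  · exfalso
    rcases eq_or_ne (ϖ + σ ϖ) 0 with h0 | h0
    · rw [h0, map_zero, v_varpi_pow hϖ] at h
      exact exp_ne_zero h.symm
    · obtain ⟨p, hp⟩ := hfix _ (map_add_map_eq_self hσ ϖ) h0
      rw [hp, v_varpi_pow hϖ, exp_inj] at h
      obtain ⟨r, hr⟩ := hodd
      omega
  · exact h

/-- **`Odd d ↔ d = t + 1`** («R-P» iff the different exponent is the maximal `2e_F + 1`; `t` is even). [cite: Serre1979, Ch. III §6 Prop. 13] -/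
theorem odd_iff_eq_succ (hσ : ∀ x, σ (σ x) = x)
    (hfix : ∀ x : K, σ x = x → x ≠ 0 → ∃ n : ℤ, Valued.v x = exp (2 * n))
    (hϖ : Valued.v ϖ = exp (-1 : ℤ)) (hd : Valued.v (ϖ - σ ϖ) = Valued.v ϖ ^ d) (ht : Valued.v (2 : K) = Valued.v ϖ ^ t) :
    Odd d ↔ d = t + 1 := by
  refine ⟨eq_succ_of_odd hσ hfix hϖ hd ht, fun h => ?_⟩
  obtain ⟨e, he⟩ := even_t hfix hϖ ht
  exact ⟨e, by omega⟩

/-- `d` even `⇒ v(Tr ϖ) = (vϖ)^d` («R-U»: the different is generated by the trace of the uniformiser). [cite: Serre1979, Ch. III §6 Prop. 13] -/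
theorem v_trace_varpi_eq_of_even (hσ : ∀ x, σ (σ x) = x)
    (hfix : ∀ x : K, σ x = x → x ≠ 0 → ∃ n : ℤ, Valued.v x = exp (2 * n))
    (hϖ : Valued.v ϖ = exp (-1 : ℤ)) (hd : Valued.v (ϖ - σ ϖ) = Valued.v ϖ ^ d) (ht : Valued.v (2 : K) = Valued.v ϖ ^ t)
    (hev : Even d) : Valued.v (ϖ + σ ϖ) = Valued.v ϖ ^ d := by
  rcases v_trace_varpi_eq_or hσ hfix hϖ hd ht with h | h
  · exact h
  · exfalso
    obtain ⟨e, he⟩ := even_t hfix hϖ ht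
    obtain ⟨r, hr⟩ := hev
    omega

/-- `d` odd `⇒ v(Tr ϖ) ≤ (vϖ)^{d+1}` (even exponent below an odd bound). [cite: Serre1979, Ch. III §6 Prop. 13] -/
theorem v_trace_varpi_le_succ_of_odd (hσ : ∀ x, σ (σ x) = x)
    (hfix : ∀ x : K, σ x = x → x ≠ 0 → ∃ n : ℤ, Valued.v x = exp (2 * n))
    (hϖ : Valued.v ϖ = exp (-1 : ℤ)) (hd : Valued.v (ϖ - σ ϖ) = Valued.v ϖ ^ d) (ht : Valued.v (2 : K) = Valued.v ϖ ^ t)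
    (hodd : Odd d) : Valued.v (ϖ + σ ϖ) ≤ Valued.v ϖ ^ (d + 1) := by
  rcases eq_or_ne (ϖ + σ ϖ) 0 with h0 | h0
  · rw [h0, map_zero]
    exact zero_le
  · obtain ⟨p, hp⟩ := hfix _ (map_add_map_eq_self hσ ϖ) h0
    have h := v_trace_varpi_le hσ hfix hϖ hd ht
    rw [hp, v_varpi_pow hϖ, exp_le_exp] at h
    rw [hp, v_varpi_pow hϖ, exp_le_exp]
    obtain ⟨r, hr⟩ := hodd
    push_cast
    omega

/-! ## §4 Trace images `Tr 𝔭_E^j = 𝔭_F^{⌊(j+d)∕2⌋}` (division-free: `2m ≤ j + d`, resp. `j + d ≤ 2m + 1`) -/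

/-- **`Tr 𝔭_E^j ⊆ 𝔭_F^{⌊(j+d)∕2⌋}`**: if `v x ≤ exp(−j)` and `2m ≤ j + d` then `v(x + σx) ≤ exp(−2m)`.  Proof in coordinates `x = a + bϖ` (★ `exists_fixed_coords_of_map_ne`,
★ `v_fixed_add_fixed_mul_eq_max`): `Tr x = 2a + b·Tr ϖ` with `v(2a) = exp(−t)·v a`, `v(b·Tr ϖ) ≤ v b·(vϖ)^d`, and the parities of `t` (even), `v a`, `v b` (even) close
the half-integer gap. [cite: Serre1979, Ch. III §3 Prop. 7] -/
theorem v_add_map_le_exp (hσ : ∀ x, σ (σ x) = x)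
    (hfix : ∀ x : K, σ x = x → x ≠ 0 → ∃ n : ℤ, Valued.v x = exp (2 * n))
    (hϖ : Valued.v ϖ = exp (-1 : ℤ)) (hd : Valued.v (ϖ - σ ϖ) = Valued.v ϖ ^ d) (ht : Valued.v (2 : K) = Valued.v ϖ ^ t)
    {x : K} {j m : ℤ} (hx : Valued.v x ≤ exp (-j)) (hm : 2 * m ≤ j + d) :
    Valued.v (x + σ x) ≤ exp (-(2 * m)) := by
  obtain ⟨a, b, ha, hb, rfl⟩ := exists_fixed_coords_of_map_ne hσ (map_varpi_ne hϖ hd) x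
  have hsplit := v_fixed_add_fixed_mul_eq_max (even_log_v_of_fixed hfix) hϖ ha hb
  rw [hsplit] at hx
  have hva : Valued.v a ≤ exp (-j) := (le_max_left _ _).trans hx
  have hvb : Valued.v b * exp (-1 : ℤ) ≤ exp (-j) := (le_max_right _ _).trans hx
  obtain ⟨e, he⟩ := even_t hfix hϖ ht
  have hdt := d_le_succ_t hσ hfix hϖ hd ht
  rw [add_map_of_coords ha hb]
  refine (Valuation.map_add _ _ _).trans (max_le ?_ ?_)
  · rcases eq_or_ne a 0 with rfl | ha0
    · rw [mul_zero, map_zero]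
      exact zero_le
    obtain ⟨n, hn⟩ := hfix a ha ha0
    rw [hn, exp_le_exp] at hva
    rw [map_mul, ht, v_varpi_pow hϖ, hn, ← exp_add, exp_le_exp]
    omega
  · rcases eq_or_ne b 0 with rfl | hb0
    · rw [zero_mul, map_zero]
      exact zero_le
    rcases eq_or_ne (ϖ + σ ϖ) 0 with h0 | h0
    · rw [h0, mul_zero, map_zero]
      exact zero_le
    obtain ⟨n, hn⟩ := hfix b hb hb0
    obtain ⟨p, hp⟩ := hfix _ (map_add_map_eq_self hσ ϖ) h0
    have hτ := v_trace_varpi_le hσ hfix hϖ hd ht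
    rw [hp, v_varpi_pow hϖ, exp_le_exp] at hτ
    rw [hn, ← exp_add, exp_le_exp] at hvb
    rw [map_mul, hn, hp, ← exp_add, exp_le_exp]
    omega

/-- **`𝔭_F^{⌊(j+d)∕2⌋} ⊆ Tr 𝔭_E^j`**: every `σ`-fixed `y` with `v y ≤ exp(−2m)` and `j + d ≤ 2m + 1` is `x + σx` for some `x` with `v x ≤ exp(−j)` — explicitly `x = y∕2`
when `d = t + 1` and `x = (y∕Tr ϖ)·ϖ` when `v(Tr ϖ) = (vϖ)^d` (§3 dichotomy). [cite: Serre1979, Ch. III §3 Prop. 7] -/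
theorem exists_v_le_add_map_eq (hσ : ∀ x, σ (σ x) = x)
    (hfix : ∀ x : K, σ x = x → x ≠ 0 → ∃ n : ℤ, Valued.v x = exp (2 * n))
    (hϖ : Valued.v ϖ = exp (-1 : ℤ)) (hd : Valued.v (ϖ - σ ϖ) = Valued.v ϖ ^ d) (ht : Valued.v (2 : K) = Valued.v ϖ ^ t)
    {y : K} (hy : σ y = y) {j m : ℤ} (hvy : Valued.v y ≤ exp (-(2 * m))) (hjm : j + d ≤ 2 * m + 1) :
    ∃ x : K, Valued.v x ≤ exp (-j) ∧ x + σ x = y := by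
  rcases v_trace_varpi_eq_or hσ hfix hϖ hd ht with h | h
  · -- «R-U» branch: `v(Tr ϖ) = (vϖ)^d`, preimage `(y ∕ Tr ϖ)·ϖ`
    have h0 : ϖ + σ ϖ ≠ 0 := fun h0 => by
      rw [h0, map_zero, v_varpi_pow hϖ] at h
      exact exp_ne_zero h.symm
    refine ⟨y / (ϖ + σ ϖ) * ϖ, ?_, ?_⟩
    · have hv : Valued.v (y / (ϖ + σ ϖ) * ϖ) = Valued.v y * exp ((d : ℤ) - 1) := by
        rw [map_mul, map_div₀, h, v_varpi_pow hϖ, hϖ, div_eq_mul_inv, ← exp_neg, neg_neg, mul_assoc, ← exp_add,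
          sub_eq_add_neg]
      rw [hv]
      calc Valued.v y * exp ((d : ℤ) - 1) ≤ exp (-(2 * m)) * exp ((d : ℤ) - 1) := mul_le_mul_left hvy _
        _ = exp (-(2 * m) + ((d : ℤ) - 1)) := (exp_add _ _).symm
        _ ≤ exp (-j) := exp_le_exp.2 (by omega)
    · rw [map_mul, map_div₀, hy, map_add_map_eq_self hσ ϖ, ← mul_add, div_mul_cancel₀ y h0]
  · -- «R-P» branch: `d = t + 1`, preimage `y ∕ 2`
    have h2 := two_ne_zero hϖ ht
    refine ⟨y / 2, ?_, ?_⟩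
    · have hv : Valued.v (y / 2) = Valued.v y * exp (t : ℤ) := by
        rw [map_div₀, ht, v_varpi_pow hϖ, div_eq_mul_inv, ← exp_neg, neg_neg]
      rw [hv]
      calc Valued.v y * exp (t : ℤ) ≤ exp (-(2 * m)) * exp (t : ℤ) := mul_le_mul_left hvy _
        _ = exp (-(2 * m) + t) := (exp_add _ _).symm
        _ ≤ exp (-j) := exp_le_exp.2 (by omega)
    · rw [map_div₀, hy, map_ofNat]
      field_simp
      ring

/-! ## §5 Corollaries at `j = 0`: `Tr 𝒪_E = 𝔭_F^{⌊d∕2⌋}`; no integral trace-one element once `d ≥ 2`; the tame sanity check -/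

/-- **`Tr 𝒪_E ⊆ 𝔭_F^{⌊d∕2⌋}`**: `v x ≤ 1`, `2m ≤ d ⇒ v(x + σx) ≤ exp(−2m)`. [cite: Serre1979, Ch. III §3 Prop. 7] -/
theorem v_add_map_le_exp_of_v_le_one (hσ : ∀ x, σ (σ x) = x)
    (hfix : ∀ x : K, σ x = x → x ≠ 0 → ∃ n : ℤ, Valued.v x = exp (2 * n))
    (hϖ : Valued.v ϖ = exp (-1 : ℤ)) (hd : Valued.v (ϖ - σ ϖ) = Valued.v ϖ ^ d) (ht : Valued.v (2 : K) = Valued.v ϖ ^ t)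
    {x : K} (hx : Valued.v x ≤ 1) {m : ℤ} (hm : 2 * m ≤ d) : Valued.v (x + σ x) ≤ exp (-(2 * m)) :=
  v_add_map_le_exp hσ hfix hϖ hd ht (j := 0) (by rwa [neg_zero, exp_zero]) (by rwa [zero_add])

/-- **NO INTEGRAL ELEMENT OF UNIT TRACE ONCE `d ≥ 2`**: `v x ≤ 1 ⇒ v(x + σx) < 1` (indeed `≤ exp(−2)`; `Tr 𝒪_E ⊆ 𝔭_F`).  At every WILD place (`d ≥ 2`) the hypothesis
`htrace : ∃ t, t + σt = 1 ∧ |t| ≤ 1` of ★ `UnitaryLatticeTreeSelfDualTransitiveOfTrace` is therefore unavailable. [cite: Serre1979, Ch. III §3 Prop. 7] -/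
theorem v_add_map_lt_one_of_two_le (hσ : ∀ x, σ (σ x) = x)
    (hfix : ∀ x : K, σ x = x → x ≠ 0 → ∃ n : ℤ, Valued.v x = exp (2 * n))
    (hϖ : Valued.v ϖ = exp (-1 : ℤ)) (hd : Valued.v (ϖ - σ ϖ) = Valued.v ϖ ^ d) (ht : Valued.v (2 : K) = Valued.v ϖ ^ t)
    (h2d : 2 ≤ d) {x : K} (hx : Valued.v x ≤ 1) : Valued.v (x + σ x) < 1 := by
  have h := v_add_map_le_exp_of_v_le_one hσ hfix hϖ hd ht hx (m := 1) (by omega)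
  exact h.trans_lt (by rw [← exp_zero, exp_lt_exp]; norm_num)

/-- … in particular `x + σx ≠ 1` for every integral `x` once `d ≥ 2`. [cite: Serre1979, Ch. III §3 Prop. 7] -/
theorem add_map_ne_one_of_two_le (hσ : ∀ x, σ (σ x) = x)
    (hfix : ∀ x : K, σ x = x → x ≠ 0 → ∃ n : ℤ, Valued.v x = exp (2 * n))
    (hϖ : Valued.v ϖ = exp (-1 : ℤ)) (hd : Valued.v (ϖ - σ ϖ) = Valued.v ϖ ^ d) (ht : Valued.v (2 : K) = Valued.v ϖ ^ t)
    (h2d : 2 ≤ d) {x : K} (hx : Valued.v x ≤ 1) : x + σ x ≠ 1 := by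
  intro h1
  have h := v_add_map_lt_one_of_two_le hσ hfix hϖ hd ht h2d hx
  rw [h1, map_one] at h
  exact lt_irrefl _ h

/-- **`𝔭_F^{⌊d∕2⌋} ⊆ Tr 𝒪_E`**: every `σ`-fixed `y` with `v y ≤ exp(−2m)`, `d ≤ 2m + 1`, is the trace of an INTEGRAL element. [cite: Serre1979, Ch. III §3 Prop. 7] -/
theorem exists_integral_add_map_eq (hσ : ∀ x, σ (σ x) = x)
    (hfix : ∀ x : K, σ x = x → x ≠ 0 → ∃ n : ℤ, Valued.v x = exp (2 * n))
    (hϖ : Valued.v ϖ = exp (-1 : ℤ)) (hd : Valued.v (ϖ - σ ϖ) = Valued.v ϖ ^ d) (ht : Valued.v (2 : K) = Valued.v ϖ ^ t)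
    {y : K} (hy : σ y = y) {m : ℤ} (hvy : Valued.v y ≤ exp (-(2 * m))) (hdm : (d : ℤ) ≤ 2 * m + 1) :
    ∃ x : K, Valued.v x ≤ 1 ∧ x + σ x = y := by
  obtain ⟨x, hx, h⟩ := exists_v_le_add_map_eq hσ hfix hϖ hd ht hy (j := 0) hvy (by rwa [zero_add])
  exact ⟨x, by rwa [neg_zero, exp_zero] at hx, h⟩

/-- TAME SANITY CHECK: at `d = 1` an INTEGRAL element of trace `1` exists (`ϖ ∕ Tr ϖ` when `t ≥ 1`, `1∕2` when `t = 0`) — the `htrace` supplier of ★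
`UnitaryLatticeTreeSelfDualTransitiveOfTrace` in the tame datum. [cite: Serre1979, Ch. III §3 Prop. 7] -/
theorem exists_integral_add_map_eq_one_of_d_eq_one (hσ : ∀ x, σ (σ x) = x)
    (hfix : ∀ x : K, σ x = x → x ≠ 0 → ∃ n : ℤ, Valued.v x = exp (2 * n))
    (hϖ : Valued.v ϖ = exp (-1 : ℤ)) (hd : Valued.v (ϖ - σ ϖ) = Valued.v ϖ ^ d) (ht : Valued.v (2 : K) = Valued.v ϖ ^ t)
    (hd1 : d = 1) : ∃ x : K, Valued.v x ≤ 1 ∧ x + σ x = 1 :=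
  exists_integral_add_map_eq hσ hfix hϖ hd ht (map_one σ) (m := 0) (by rw [mul_zero, neg_zero, exp_zero, map_one])
    (by rw [hd1]; norm_num)

end Literature.NumberTheory.LocalFields.WildQuadraticDatum
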